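import Summits.QuantumFields.YangMills.Theorems.AllWindowsColdBoxBoxHighLineFPOperatorInverseRowSums
import Mathlib.Algebra.QuadraticDiscriminant

/-!
# Capacity inequalities for the interior Dirichlet Laplacian and the Faddeev–Popov operator: ONE site costs `O(1)` Dirichlet energy and
# `O((1 + log H)⁴)` squared divergence — uniformly in the box size (no `H⁴`)

Width seat `ym-line-sfw-p2-w2` (prover-ym-line-sfw-p2-w2-g32-0).  Free-hands planning input for the recorded lift **L1** of the next rung U5
(`Cruxes/BoxWindowHighSU2213/U5-BLOCKERS.md` §1 B1 / §2 L1, planner ym-idea-2 g18).  The honest window count of the Jacobian assembly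
(✓`OrbitJacobian.orbitNormaliserJacobianR_of`, bus ym-idea-1 2026-08-29T22:01Z) has a THIRD `H¹²` source besides the ℓ² fixed point (lifted by
✓J2∞/J4∞) and the `e^{−cH⁴}` precision: the FAR region starts at the injectivity radius `a₀ ≍ H⁻²`, and its Laplace cost `e^{−β c₅ a₀²/H⁴}` uses
✓J5a `farRegionPhiLowerBall`, `c₅ ‖A x₀‖² ≤ H⁴ · landauPhi` — the GLOBAL ℓ²-coercivity ✓4ℓ read at one site.  The LINEAR MODEL of the sharp
single-site bound is a capacity inequality, and in `d = 4` capacities of points are bounded below uniformly in the volume.  This file proves the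
linear statements (the nonlinear J5a′/J5a″ = ✓4ℓ's proof with the capacity step in place of the Poincaré step is NOT here):

* `Capacity.sq_dotProduct_mulVec_le` — energy Cauchy–Schwarz `(u·Lv)² ≤ (u·Lu)(v·Lv)` for a symmetric nonnegative form (discriminant);
* `Capacity.sq_apply_le_inv_diag_mul` — **capacity**: `(v i)² ≤ (L⁻¹)ᵢᵢ · (v·Lv)` for a real positive definite `L`
  (test vector `u = L⁻¹ eᵢ`: `u·Lv = vᵢ`, `u·Lu = (L⁻¹)ᵢᵢ`);
* `Capacity.sq_apply_le_inv_row_sq_mul` — **second-order capacity**: `(v i)² ≤ (Σ_j (L⁻¹ i j)²) · ‖Lv‖²` for invertible `L` (plain Cauchy–Schwarz on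
  `v = L⁻¹(Lv)`);
* `Capacity.interiorGreen_diag_le` — the Dirichlet Green diagonal is bounded: `(Δ_I⁻¹) x x ≤ C₀` (✓`boxLap_inv_size_decay` at `s = t`, transported along
  w4's ✓`OrbitMapSurj.dirichletMatrix_interior_submatrix_eq_boxLap`);
* ★ `Capacity.sq_apply_le_mul_dirichletQuadForm` — `(v x)² ≤ C₀ · (v ⬝ᵥ Δ_I *ᵥ v)` for EVERY interior site, uniformly in `H ≥ 1`
  (Laplacian capacity: raising one site to height `a` costs Dirichlet energy `≥ a²/C₀`; Literature ✓`posDef_dirichletMatrix`);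
* ★ `Capacity.sq_apply_le_mul_normSq_dirichlet` — `(v x)² ≤ C_HS (1 + log H)⁴ · ‖Δ_I v‖²` (bi-Laplacian capacity, ✓`OrbitMapSurj.interiorGreen_row_sq_le`);
* ★★ `Capacity.sq_apply_le_mul_normSq_fpOperator` — on the `r₀`-ball `C_r·r₀·H² ≤ 1`: `(v p)² ≤ C_r (1 + log H)⁴ · ‖fpOperator H V v‖²` for every
  coordinate `p` (w4's ✓`OrbitMapSurj.fpOperator_inv_row_sq_le`); at `V = 1` this is the linearisation of `landauPhi` (✓`fpOperator_mulVec`: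
  `F v` = the linearised divergence defect, `landauPhi = Σ ‖divDefect‖²`): **one Pauli coordinate of size `a` forces squared divergence
  `≥ a²/(C (1 + log H)⁴)`** — against ✓J5a's `a²·c₅/H⁴`.

With J5a′ in this shape the far-region cost of the Jacobian assembly becomes `e^{−cβ a₀²/polylog H} = e^{−cβ/(H⁴ polylog)}` against `e^{C H⁴ log β}`, i.e.
the window `H⁸·polylog ≤ β` (**`8θ < 1`**), matching ✓J4∞.  Everything proved; no definitions; Mathlib + tree only; standard axioms.
HONEST LABEL: linear-algebra glue / planning input for the recorded lift L1 of the NEXT rung U5 (LINE-20 ⟨stmt-QuantumFields-24336⟩, unstaffed, gated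
by the critic's N2/I23); the nonlinear far-region bound J5a′ is NOT proved here; S5, U5, ⟨24004⟩ ⟨24335⟩ ⟨24336⟩ remain OPEN; no stub is closed by name;
no crux, rung or summit is proved; **the Yang–Mills mass gap is NOT proved by this file; no summit is proved by a line.**
-/

set_option autoImplicit false

open Matrix Finset
open Literature.MathematicalPhysics.QuantumFieldTheory.AxialGauge (boxEdges)
open Literature.MathematicalPhysics.QuantumLattice (LGConfig)
open Literature.Probability.LatticeModels (Site dirichletMatrix)
open Summit.QuantumFields.YangMills.Theorems.AllWindowsColdBox.BoxKernel (Box boxLap boxLap_inv_size_decay)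

namespace Summit.QuantumFields.YangMills.Theorems.AllWindowsColdBoxBoxHighLine

namespace Capacity

/-! ## 1. Abstract capacity inequalities -/

section Abstract

variable {ι : Type*} [Fintype ι] [DecidableEq ι]

omit [DecidableEq ι] in
/-- A symmetric real matrix gives a symmetric bilinear form: `u·(Lv) = v·(Lu)`. -/
theorem dotProduct_mulVec_comm_of_transpose_eq (L : Matrix ι ι ℝ) (hL : Lᵀ = L) (u v : ι → ℝ) :
    u ⬝ᵥ (L *ᵥ v) = v ⬝ᵥ (L *ᵥ u) := by
  rw [Matrix.dotProduct_mulVec, ← Matrix.mulVec_transpose, hL, dotProduct_comm]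

omit [DecidableEq ι] in
/-- **Energy Cauchy–Schwarz**: for a symmetric nonnegative form, `(u·Lv)² ≤ (u·Lu)·(v·Lv)` (the discriminant of `t ↦ (v − t u)·L(v − t u) ≥ 0`). -/
theorem sq_dotProduct_mulVec_le (L : Matrix ι ι ℝ) (hL : Lᵀ = L) (hpos : ∀ w : ι → ℝ, 0 ≤ w ⬝ᵥ (L *ᵥ w)) (u v : ι → ℝ) :
    (u ⬝ᵥ (L *ᵥ v)) ^ 2 ≤ (u ⬝ᵥ (L *ᵥ u)) * (v ⬝ᵥ (L *ᵥ v)) := by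
  have hq : ∀ t : ℝ, 0 ≤ (u ⬝ᵥ (L *ᵥ u)) * (t * t) + (-(2 * (u ⬝ᵥ (L *ᵥ v)))) * t + v ⬝ᵥ (L *ᵥ v) := by
    intro t
    have h := hpos (v - t • u)
    have hsym := dotProduct_mulVec_comm_of_transpose_eq L hL v u
    have hexp : (v - t • u) ⬝ᵥ (L *ᵥ (v - t • u)) =
        (u ⬝ᵥ (L *ᵥ u)) * (t * t) + (-(2 * (u ⬝ᵥ (L *ᵥ v)))) * t + v ⬝ᵥ (L *ᵥ v) := by
      simp only [Matrix.mulVec_sub, Matrix.mulVec_smul, sub_dotProduct, dotProduct_sub, smul_dotProduct, dotProduct_smul,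
        smul_eq_mul]
      rw [hsym]
      ring
    rw [hexp] at h
    exact h
  have hd := discrim_le_zero hq
  rw [discrim] at hd
  nlinarith [hd]

/-- **Capacity inequality**: for a real positive definite `L` and every coordinate `i`, `(v i)² ≤ (L⁻¹) i i · (v·Lv)`
(energy Cauchy–Schwarz with the test vector `u = L⁻¹ eᵢ`, for which `u·Lv = v i` and `u·Lu = (L⁻¹) i i`). -/
theorem sq_apply_le_inv_diag_mul (L : Matrix ι ι ℝ) (hL : L.PosDef) (v : ι → ℝ) (i : ι) :
    v i ^ 2 ≤ L⁻¹ i i * (v ⬝ᵥ (L *ᵥ v)) := by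
  have hT : Lᵀ = L := by
    have h := hL.isHermitian
    rw [Matrix.IsHermitian, Matrix.conjTranspose_eq_transpose_of_trivial] at h
    exact h
  have hpos : ∀ w : ι → ℝ, 0 ≤ w ⬝ᵥ (L *ᵥ w) := fun w => by
    simpa only [star_trivial] using hL.posSemidef.dotProduct_mulVec_nonneg w
  have hdet : IsUnit L.det := (Matrix.isUnit_iff_isUnit_det _).1 hL.isUnit
  set u : ι → ℝ := L⁻¹ *ᵥ Pi.single i 1 with hu
  have hLu : L *ᵥ u = Pi.single i 1 := by
    rw [hu, Matrix.mulVec_mulVec, Matrix.mul_nonsing_inv _ hdet, Matrix.one_mulVec]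
  have huv : u ⬝ᵥ (L *ᵥ v) = v i := by
    rw [dotProduct_mulVec_comm_of_transpose_eq L hT u v, hLu, dotProduct_single, mul_one]
  have huu : u ⬝ᵥ (L *ᵥ u) = L⁻¹ i i := by
    rw [hLu, dotProduct_single, mul_one, hu, Matrix.mulVec_single_one]
    rfl
  have h := sq_dotProduct_mulVec_le L hT hpos u v
  rw [huv, huu] at h
  exact h

/-- **Second-order capacity**: for invertible `L`, `(v i)² ≤ (Σ_j (L⁻¹ i j)²) · ‖L v‖²` (Cauchy–Schwarz on `v = L⁻¹ (L v)`). -/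
theorem sq_apply_le_inv_row_sq_mul (L : Matrix ι ι ℝ) (hL : IsUnit L.det) (v : ι → ℝ) (i : ι) :
    v i ^ 2 ≤ (∑ j, L⁻¹ i j ^ 2) * ((L *ᵥ v) ⬝ᵥ (L *ᵥ v)) := by
  have hv : v i = ∑ j, L⁻¹ i j * (L *ᵥ v) j := by
    have h : v = L⁻¹ *ᵥ (L *ᵥ v) := by rw [Matrix.mulVec_mulVec, Matrix.nonsing_inv_mul _ hL, Matrix.one_mulVec]
    conv_lhs => rw [h]
    rfl
  rw [hv, dotProduct]
  have h := Finset.sum_mul_sq_le_sq_mul_sq Finset.univ (fun j => L⁻¹ i j) (fun j => (L *ᵥ v) j)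
  refine h.trans (le_of_eq ?_)
  congr 1
  exact Finset.sum_congr rfl fun j _ => by ring

end Abstract

/-! ## 2. The interior Dirichlet Laplacian: bounded Green diagonal (`d = 4`) -/

variable {H : ℕ}

/-- **The Dirichlet Green diagonal is bounded uniformly in the box**: `(dirichletMatrix (interiorSites H))⁻¹ x x ≤ C₀` for `H ≥ 1`
(✓`boxLap_inv_size_decay` at `s = t`, transported along the coordinate bijection). -/
theorem interiorGreen_diag_le : ∃ C₀ : ℝ, 0 ≤ C₀ ∧ ∀ H : ℕ, 1 ≤ H → ∀ x : ↥(interiorSites H),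
    (dirichletMatrix (interiorSites H))⁻¹ x x ≤ C₀ := by
  obtain ⟨C₀, hC₀, hdec⟩ := boxLap_inv_size_decay
  refine ⟨C₀, hC₀, fun H hH x => ?_⟩
  haveI : NeZero (2 * H) := ⟨by omega⟩
  set e := Equiv.ofBijective _ (OrbitMapSurj.coordsEquivInterior_bijective (H := H)) with he
  have hinv : (boxLap (2 * H) Finset.univ)⁻¹ = ((dirichletMatrix (interiorSites H))⁻¹).submatrix e e := by
    rw [← OrbitMapSurj.dirichletMatrix_interior_submatrix_eq_boxLap, Matrix.inv_submatrix_equiv]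
  obtain ⟨κ⟩ := (inferInstance : Nonempty (Fin 4))
  have h := hdec (2 * H) Finset.univ Finset.univ_nonempty κ (e.symm x) (e.symm x)
  rw [sub_self, abs_zero, add_zero, one_pow, mul_one, hinv, Matrix.submatrix_apply, Equiv.apply_symm_apply] at h
  exact (le_abs_self _).trans h

/-- ★ **Laplacian capacity of a point, uniformly in the box**: `(v x)² ≤ C₀ · (v ⬝ᵥ Δ_I *ᵥ v)` for every `H ≥ 1`, `v`, interior `x`
(raising one interior site to height `a` costs Dirichlet energy `≥ a²/C₀`). -/
theorem sq_apply_le_mul_dirichletQuadForm : ∃ C₀ : ℝ, 0 ≤ C₀ ∧ ∀ H : ℕ, 1 ≤ H →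
    ∀ (v : ↥(interiorSites H) → ℝ) (x : ↥(interiorSites H)),
      v x ^ 2 ≤ C₀ * (v ⬝ᵥ (dirichletMatrix (interiorSites H) *ᵥ v)) := by
  obtain ⟨C₀, hC₀, hdiag⟩ := interiorGreen_diag_le
  refine ⟨C₀, hC₀, fun H hH v x => ?_⟩
  have hpd : (dirichletMatrix (interiorSites H)).PosDef :=
    Literature.Probability.LatticeModels.posDef_dirichletMatrix (by norm_num) _
  have hQ : 0 ≤ v ⬝ᵥ (dirichletMatrix (interiorSites H) *ᵥ v) := by
    simpa only [star_trivial] using hpd.posSemidef.dotProduct_mulVec_nonneg v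
  exact (sq_apply_le_inv_diag_mul _ hpd v x).trans (mul_le_mul_of_nonneg_right (hdiag H hH x) hQ)

/-- ★ **Bi-Laplacian capacity of a point**: `(v x)² ≤ C_HS (1 + log H)⁴ · ‖Δ_I v‖²` for every `H ≥ 1`, `v`, interior `x`
(✓`OrbitMapSurj.interiorGreen_row_sq_le`: the ℓ² rows of the Green's function are `O((1 + log H)⁴)` in `d = 4`). -/
theorem sq_apply_le_mul_normSq_dirichlet : ∃ C : ℝ, 0 ≤ C ∧ ∀ H : ℕ, 1 ≤ H →
    ∀ (v : ↥(interiorSites H) → ℝ) (x : ↥(interiorSites H)),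
      v x ^ 2 ≤ C * (1 + Real.log H) ^ 4 *
        ((dirichletMatrix (interiorSites H) *ᵥ v) ⬝ᵥ (dirichletMatrix (interiorSites H) *ᵥ v)) := by
  obtain ⟨C, hC, hrow⟩ := OrbitMapSurj.interiorGreen_row_sq_le
  refine ⟨C, hC, fun H hH v x => ?_⟩
  have hdet : IsUnit (dirichletMatrix (interiorSites H)).det :=
    Literature.Probability.LatticeModels.isUnit_det_dirichletMatrix (by norm_num) _
  have hQ : 0 ≤ (dirichletMatrix (interiorSites H) *ᵥ v) ⬝ᵥ (dirichletMatrix (interiorSites H) *ᵥ v) :=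
    Finset.sum_nonneg fun i _ => mul_self_nonneg _
  exact (sq_apply_le_inv_row_sq_mul _ hdet v x).trans (mul_le_mul_of_nonneg_right (hrow H hH x) hQ)

/-! ## 3. The Faddeev–Popov operator on the `r₀`-ball -/

/-- ★★ **Second-order capacity for the Faddeev–Popov operator on the `r₀`-ball**: one constant `C > 0` such that for `H ≥ 1`, `r₀ ≥ 0`,
`C·r₀·H² ≤ 1` and every `V` with cold-box links within defect `r₀²`, every coordinate satisfies
`(v p)² ≤ C · (1 + log H)⁴ · ‖fpOperator H V v‖²`.  At `V = 1`, `fpOperator H 1 v` is the linearised divergence defect of the Pauli field of `v`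
(✓`fpOperator_mulVec`), so this is the linear model of a single-site far-region bound `‖A x₀‖² ≤ C (1 + log H)⁴ · Φ` — against ✓J5a's `H⁴`. -/
theorem sq_apply_le_mul_normSq_fpOperator : ∃ C : ℝ, 0 < C ∧ ∀ H : ℕ, 1 ≤ H → ∀ r₀ : ℝ, 0 ≤ r₀ → C * r₀ * (H : ℝ) ^ 2 ≤ 1 →
    ∀ V : LGConfig 4 SU2, (∀ e ∈ boxEdges 4 (2 * H + 1), linkDefect V e ≤ r₀ ^ 2) →
      ∀ (v : ↥(interiorSites H) × Fin 3 → ℝ) (p : ↥(interiorSites H) × Fin 3),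
        v p ^ 2 ≤ C * (1 + Real.log H) ^ 4 * ((fpOperator H V *ᵥ v) ⬝ᵥ (fpOperator H V *ᵥ v)) := by
  obtain ⟨C_r, hCr, hrow⟩ := OrbitMapSurj.fpOperator_inv_row_sq_le
  obtain ⟨C_F, hCF, hF⟩ := OrbitMapSup.fpOperator_inv_row_abs_le
  refine ⟨C_r + C_F, by positivity, fun H hH r₀ hr₀ hC V hV v p => ?_⟩
  have hH' : (1 : ℝ) ≤ H := by exact_mod_cast hH
  have hrH : 0 ≤ r₀ * (H : ℝ) ^ 2 := by positivity
  have hCr' : C_r * r₀ * (H : ℝ) ^ 2 ≤ 1 := by nlinarith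
  have hCF' : C_F * r₀ * (H : ℝ) ^ 2 ≤ 1 := by nlinarith
  have hdet : IsUnit (fpOperator H V).det := (hF H hH r₀ hr₀ hCF' V hV).1
  have hQ : 0 ≤ (fpOperator H V *ᵥ v) ⬝ᵥ (fpOperator H V *ᵥ v) := Finset.sum_nonneg fun i _ => mul_self_nonneg _
  have hL4 : 0 ≤ (1 + Real.log H) ^ 4 := pow_nonneg (add_nonneg zero_le_one (Real.log_nonneg hH')) 4
  calc v p ^ 2 ≤ (∑ j, (fpOperator H V)⁻¹ p j ^ 2) * ((fpOperator H V *ᵥ v) ⬝ᵥ (fpOperator H V *ᵥ v)) :=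
        sq_apply_le_inv_row_sq_mul _ hdet v p
    _ ≤ C_r * (1 + Real.log H) ^ 4 * ((fpOperator H V *ᵥ v) ⬝ᵥ (fpOperator H V *ᵥ v)) :=
        mul_le_mul_of_nonneg_right (hrow H hH r₀ hr₀ hCr' V hV p) hQ
    _ ≤ (C_r + C_F) * (1 + Real.log H) ^ 4 * ((fpOperator H V *ᵥ v) ⬝ᵥ (fpOperator H V *ᵥ v)) := by
        have : 0 ≤ (1 + Real.log H) ^ 4 * ((fpOperator H V *ᵥ v) ⬝ᵥ (fpOperator H V *ᵥ v)) := mul_nonneg hL4 hQ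
        nlinarith

/-- **Field form at a site**: on the `r₀`-ball, `‖(♭⁻¹v)_x‖² ≤ 3C · (1 + log H)⁴ · ‖fpOperator H V v‖²` for every interior site `x`
(the three colours of `x`). -/
theorem normSq_vecToField_le_mul_normSq_fpOperator : ∃ C : ℝ, 0 < C ∧ ∀ H : ℕ, 1 ≤ H → ∀ r₀ : ℝ, 0 ≤ r₀ → C * r₀ * (H : ℝ) ^ 2 ≤ 1 →
    ∀ V : LGConfig 4 SU2, (∀ e ∈ boxEdges 4 (2 * H + 1), linkDefect V e ≤ r₀ ^ 2) →
      ∀ (v : ↥(interiorSites H) × Fin 3 → ℝ) (x : ↥(interiorSites H)),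
        ‖vecToField H v x‖ ^ 2 ≤ 3 * C * (1 + Real.log H) ^ 4 * ((fpOperator H V *ᵥ v) ⬝ᵥ (fpOperator H V *ᵥ v)) := by
  obtain ⟨C, hC, h⟩ := sq_apply_le_mul_normSq_fpOperator
  refine ⟨C, hC, fun H hH r₀ hr₀ hCr V hV v x => ?_⟩
  rw [EuclideanSpace.norm_eq, Real.sq_sqrt (Finset.sum_nonneg fun b _ => sq_nonneg _)]
  calc ∑ b : Fin 3, ‖vecToField H v x b‖ ^ 2 = ∑ b : Fin 3, v (x, b) ^ 2 :=
        Finset.sum_congr rfl fun b _ => by rw [vecToField_apply, Real.norm_eq_abs, sq_abs]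
    _ ≤ ∑ _b : Fin 3, C * (1 + Real.log H) ^ 4 * ((fpOperator H V *ᵥ v) ⬝ᵥ (fpOperator H V *ᵥ v)) :=
        Finset.sum_le_sum fun b _ => h H hH r₀ hr₀ hCr V hV v (x, b)
    _ = 3 * C * (1 + Real.log H) ^ 4 * ((fpOperator H V *ᵥ v) ⬝ᵥ (fpOperator H V *ᵥ v)) := by
        simp only [Finset.sum_const, Finset.card_univ, Fintype.card_fin, nsmul_eq_mul, Nat.cast_ofNat]; ring

end Capacity

end Summit.QuantumFields.YangMills.Theorems.AllWindowsColdBoxBoxHighLine
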